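import Literature.Analysis.Complex.DbarAlongCalculus
import Literature.Analysis.Complex.CauchyTransform
import Mathlib.Analysis.Calculus.FDeriv.Add
import HarnessLib

/-!
# `∂̄` on vector-valued functions in an exterior-algebra frame (Hörmander, §2.1 and §2.3)

Hörmander's proof of the `∂̄`-Poincaré lemma on polydiscs (Theorem 2.3.3) manipulates a smooth
`(p,q+1)`-form `f = ∑' f_{I,J} dz^I ∧ dz̄^J` on `ℂⁿ` only through

* the scalar operators `∂/∂z̄_j` acting on coefficients,
* the "creation" operators `dz̄_j ∧ ·` (raising the `dz̄`-degree) and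
* the "annihilation" operators `∂/∂z̄_j ⌟ ·` (extracting the coefficient of `dz̄_j`, the `g` in
  `f = dz̄_k ∧ g + h`),

and the identities between them: the canonical anticommutation relations
`(∂/∂z̄_j ⌟)(dz̄_l ∧) + (dz̄_l ∧)(∂/∂z̄_j ⌟) = δ_{jl}`, `dz̄_j ∧ dz̄_l = -dz̄_l ∧ dz̄_j`,
`(∂/∂z̄_j ⌟)(∂/∂z̄_k ⌟) = -(∂/∂z̄_k ⌟)(∂/∂z̄_j ⌟)`, and "a form of positive `dz̄`-degree all of
whose `dz̄`-coefficients vanish is zero". This file isolates that algebra in a structure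
`Literature.Analysis.Complex.DbarFrame ι Λ₀ Λ₁ Λ₂ Λ₃` on four complex Banach spaces (the forms of
types `(p,q-1)`, `(p,q)`, `(p,q+1)`, `(p,q+2)` in the application, potentials in `Λ₁`, data in `Λ₂`; any coefficient module in
general), and defines the operators

  `∂̄ u = ∑_j dz̄_j ∧ ∂u/∂z̄_j`   (`DbarFrame.dbar₁ : (ℂ^ι → Λ₁) → (ℂ^ι → Λ₂)`, and `dbar₂ : (ℂ^ι → Λ₂) → (ℂ^ι → Λ₃)`)

with `∂/∂z̄_j = dbarAlong (Pi.single j 1)` (`Literature/Analysis/Complex/CauchyPompeiu.lean`). We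
prove the two computations of Hörmander's proof that use the algebra: `∂̄ ∂̄ = 0`
(`DbarFrame.dbar₂_dbar₁`) and (2.3.4): if `∂̄ f = 0` and `f` does not involve `dz̄_j`, then the
coefficient `g = ∂/∂z̄_k ⌟ f` of `dz̄_k` is holomorphic in `z_j`
(`DbarFrame.dbarAlong_iota_eq_zero`). The `∂̄`-Poincaré lemma itself is in
`Literature/Analysis/Complex/DbarPoincarePolydiscFrame.lean`.

## References

* L. Hörmander, *An Introduction to Complex Analysis in Several Variables*, 2nd ed. (1973),
  §2.1 (the calculus of `(p,q)`-forms) and the proof of Thm. 2.3.3, (2.3.4). [HormanderSCV1973]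
-/

noncomputable section

open Set Filter Function Complex
open scoped Topology ContDiff

namespace Literature.Analysis.Complex

universe u v₀ v₁ v₂ v₃

/-- An **exterior-algebra frame for `∂̄`** over the index type `ι`: four complex normed spaces
`Λ₀, Λ₁, Λ₂, Λ₃` ("forms of `dz̄`-degrees `q-1, q, q+1, q+2`") with creation operators
`ε` (`= dz̄_j ∧ ·`, degree `+1`) and annihilation operators `ι'` (`= ∂/∂z̄_j ⌟ ·`, degree `-1`)
satisfying the canonical anticommutation relations of the exterior algebra
(Hörmander (1973), §2.1: `dz̄_j ∧ dz̄_l = -dz̄_l ∧ dz̄_j` and the coefficient calculus of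
`∑' f_{I,J} dz^I ∧ dz̄^J`), and positivity of the `dz̄`-degree of `Λ₂`: an element of `Λ₂` all of
whose `dz̄`-coefficients vanish is zero ("every term in `f` is of degree `q+1 > 0` with respect
to `dz̄`", proof of Thm. 2.3.3). [cite: HormanderSCV1973, §2.1] -/
structure DbarFrame (ι : Type u) (Λ₀ : Type v₀) (Λ₁ : Type v₁) (Λ₂ : Type v₂) (Λ₃ : Type v₃)
    [NormedAddCommGroup Λ₀] [NormedSpace ℂ Λ₀] [NormedAddCommGroup Λ₁] [NormedSpace ℂ Λ₁]
    [NormedAddCommGroup Λ₂] [NormedSpace ℂ Λ₂] [NormedAddCommGroup Λ₃] [NormedSpace ℂ Λ₃] where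
  /-- creation `dz̄_j ∧ ·` from degree `q-1` to `q` -/
  ε₀ : ι → (Λ₀ →L[ℂ] Λ₁)
  /-- creation `dz̄_j ∧ ·` from degree `q` to `q+1` -/
  ε₁ : ι → (Λ₁ →L[ℂ] Λ₂)
  /-- creation `dz̄_j ∧ ·` from degree `q+1` to `q+2` -/
  ε₂ : ι → (Λ₂ →L[ℂ] Λ₃)
  /-- annihilation `∂/∂z̄_j ⌟ ·` from degree `q` to `q-1` -/
  ι₀ : ι → (Λ₁ →L[ℂ] Λ₀)
  /-- annihilation `∂/∂z̄_j ⌟ ·` from degree `q+1` to `q` -/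
  ι₁ : ι → (Λ₂ →L[ℂ] Λ₁)
  /-- annihilation `∂/∂z̄_j ⌟ ·` from degree `q+2` to `q+1` -/
  ι₂ : ι → (Λ₃ →L[ℂ] Λ₂)
  /-- CAR in degree `q`, diagonal: `ι_j ε_j + ε_j ι_j = 1` -/
  car₁_self : ∀ (j : ι) (y : Λ₁), ι₁ j (ε₁ j y) + ε₀ j (ι₀ j y) = y
  /-- CAR in degree `q`, off-diagonal: `ι_j ε_l + ε_l ι_j = 0` for `j ≠ l` -/
  car₁_ne : ∀ (j l : ι), j ≠ l → ∀ y : Λ₁, ι₁ j (ε₁ l y) + ε₀ l (ι₀ j y) = 0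
  /-- CAR in degree `q+1`, diagonal: `ι_j ε_j + ε_j ι_j = 1` -/
  car₂_self : ∀ (j : ι) (x : Λ₂), ι₂ j (ε₂ j x) + ε₁ j (ι₁ j x) = x
  /-- CAR in degree `q+1`, off-diagonal: `ι_j ε_l + ε_l ι_j = 0` for `j ≠ l` -/
  car₂_ne : ∀ (j l : ι), j ≠ l → ∀ x : Λ₂, ι₂ j (ε₂ l x) + ε₁ l (ι₁ j x) = 0
  /-- `dz̄_j ∧ dz̄_l ∧ · = -dz̄_l ∧ dz̄_j ∧ ·` -/
  ε_ε : ∀ (j l : ι) (y : Λ₁), ε₂ j (ε₁ l y) = -ε₂ l (ε₁ j y)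
  /-- `ι_j ι_k = -ι_k ι_j` -/
  ι_ι : ∀ (j k : ι) (x : Λ₂), ι₀ j (ι₁ k x) = -ι₀ k (ι₁ j x)
  /-- positivity of the `dz̄`-degree of `Λ₂` -/
  eq_zero_of_forall_ι₁ : ∀ x : Λ₂, (∀ j, ι₁ j x = 0) → x = 0

namespace DbarFrame

variable {ι : Type u} {Λ₀ : Type v₀} {Λ₁ : Type v₁} {Λ₂ : Type v₂} {Λ₃ : Type v₃}
  [NormedAddCommGroup Λ₀] [NormedSpace ℂ Λ₀] [NormedAddCommGroup Λ₁] [NormedSpace ℂ Λ₁]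
  [NormedAddCommGroup Λ₂] [NormedSpace ℂ Λ₂] [NormedAddCommGroup Λ₃] [NormedSpace ℂ Λ₃]
  (𝔉 : DbarFrame ι Λ₀ Λ₁ Λ₂ Λ₃)

/-- `ι_k ι_k = 0` (from `ι_j ι_k = -ι_k ι_j`). [folklore] -/
theorem ι_ι_self (k : ι) (x : Λ₂) : 𝔉.ι₀ k (𝔉.ι₁ k x) = 0 := by
  have h := 𝔉.ι_ι k k x
  have h2 : (2 : ℂ) • 𝔉.ι₀ k (𝔉.ι₁ k x) = 0 := by rw [two_smul]; nth_rw 1 [h]; exact neg_add_cancel _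
  exact (smul_eq_zero.mp h2).resolve_left two_ne_zero

/-! ### Constant linear operators commute with `∂̄_v` and the Cauchy transform -/

section CLM

variable {E : Type*} [NormedAddCommGroup E] [NormedSpace ℂ E]
  {F : Type*} [NormedAddCommGroup F] [NormedSpace ℂ F]
  {G : Type*} [NormedAddCommGroup G] [NormedSpace ℂ G]

omit 𝔉 in
/-- A continuous linear operator commutes with `∂̄_v` (at points of differentiability).
[folklore] -/
theorem _root_.Literature.Analysis.Complex.dbarAlong_clm_comp (A : F →L[ℂ] G) {u : E → F} {x : E}
    (hu : DifferentiableAt ℝ u x) (v : E) :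
    dbarAlong v (fun y => A (u y)) x = A (dbarAlong v u x) := by
  have h : HasFDerivAt (fun y => A (u y)) ((A.restrictScalars ℝ).comp (fderiv ℝ u x)) x :=
    (A.restrictScalars ℝ).hasFDerivAt.comp x hu.hasFDerivAt
  rw [dbarAlong_apply, dbarAlong_apply, h.fderiv]
  simp

omit 𝔉 in
/-- `∂̄_v` of a finite sum (at points of differentiability). [folklore] -/
theorem _root_.Literature.Analysis.Complex.dbarAlong_finset_sum {α : Type*} (s : Finset α)
    {u : α → E → F} {x : E} (hu : ∀ a ∈ s, DifferentiableAt ℝ (u a) x) (v : E) :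
    dbarAlong v (fun y => ∑ a ∈ s, u a y) x = ∑ a ∈ s, dbarAlong v (u a) x := by
  simp only [dbarAlong_apply, fderiv_fun_sum hu, sum_apply, Finset.smul_sum,
    ← Finset.sum_add_distrib, smul_add]

omit 𝔉 in
/-- A continuous linear operator commutes with the Cauchy transform of a continuous compactly
supported function. [folklore] -/
theorem _root_.Literature.Analysis.Complex.cauchyTransformAlong_clm_comp [CompleteSpace F]
    [CompleteSpace G] (A : F →L[ℂ] G) {g : E → F} (hg : Continuous g)
    (hsupp : HasCompactSupport g) {v : E} (hv : v ≠ 0) (x : E) :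
    cauchyTransformAlong v (fun y => A (g y)) x = A (cauchyTransformAlong v g x) := by
  rw [cauchyTransformAlong_apply, cauchyTransformAlong_apply,
    ← A.integral_comp_comm (integrable_cauchyKernel_smul_comp hg hsupp hv x)]
  simp only [ContinuousLinearMap.map_smul]

end CLM

/-! ### The operators `∂̄` in the frame -/

variable [Fintype ι] [DecidableEq ι]

/-- **`∂̄` on `Λ₁`-valued functions**: `∂̄ u (z) = ∑_j dz̄_j ∧ ∂u/∂z̄_j (z)` (Hörmander (1973),
§2.1, the coordinate expression of `∂̄` on `(p,q)`-forms, `∂̄(∑' u_{I,J} dz^I ∧ dz̄^J)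
= ∑' ∑_j ∂u_{I,J}/∂z̄_j dz̄_j ∧ dz^I ∧ dz̄^J`). [cite: HormanderSCV1973, §2.1] -/
def dbar₁ (u : (ι → ℂ) → Λ₁) (z : ι → ℂ) : Λ₂ :=
  ∑ j, 𝔉.ε₁ j (dbarAlong (Pi.single j 1) u z)

/-- **`∂̄` on `Λ₂`-valued functions**: `∂̄ f (z) = ∑_j dz̄_j ∧ ∂f/∂z̄_j (z)`.
[cite: HormanderSCV1973, §2.1] -/
def dbar₂ (f : (ι → ℂ) → Λ₂) (z : ι → ℂ) : Λ₃ :=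
  ∑ j, 𝔉.ε₂ j (dbarAlong (Pi.single j 1) f z)

/-- Unfolding of `dbar₁`. [folklore] -/
theorem dbar₁_apply (u : (ι → ℂ) → Λ₁) (z : ι → ℂ) :
    𝔉.dbar₁ u z = ∑ j, 𝔉.ε₁ j (dbarAlong (Pi.single j 1) u z) :=
  rfl

/-- Unfolding of `dbar₂`. [folklore] -/
theorem dbar₂_apply (f : (ι → ℂ) → Λ₂) (z : ι → ℂ) :
    𝔉.dbar₂ f z = ∑ j, 𝔉.ε₂ j (dbarAlong (Pi.single j 1) f z) :=
  rfl

/-- `∂̄ 0 = 0` on `Λ₁`-valued functions. [folklore] -/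
@[simp]
theorem dbar₁_zero (z : ι → ℂ) : 𝔉.dbar₁ (0 : (ι → ℂ) → Λ₁) z = 0 := by
  simp [dbar₁_apply]

/-- `∂̄ (u + w) = ∂̄ u + ∂̄ w` at points of differentiability. [folklore] -/
theorem dbar₁_add {u w : (ι → ℂ) → Λ₁} {z : ι → ℂ} (hu : DifferentiableAt ℝ u z)
    (hw : DifferentiableAt ℝ w z) :
    𝔉.dbar₁ (fun y => u y + w y) z = 𝔉.dbar₁ u z + 𝔉.dbar₁ w z := by
  simp only [dbar₁_apply, dbarAlong_fun_add hu hw, map_add, Finset.sum_add_distrib]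

/-- `∂̄ (f - h) = ∂̄ f - ∂̄ h` on `Λ₂`-valued functions, at points of differentiability.
[folklore] -/
theorem dbar₂_sub {f h : (ι → ℂ) → Λ₂} {z : ι → ℂ} (hf : DifferentiableAt ℝ f z)
    (hh : DifferentiableAt ℝ h z) :
    𝔉.dbar₂ (fun y => f y - h y) z = 𝔉.dbar₂ f z - 𝔉.dbar₂ h z := by
  simp only [dbar₂_apply, dbarAlong_sub hf hh, map_sub, Finset.sum_sub_distrib]

/-- `∂̄` is local on `Λ₂`-valued functions. [folklore] -/
theorem dbar₂_congr_of_eventuallyEq {f h : (ι → ℂ) → Λ₂} {z : ι → ℂ} (hfh : f =ᶠ[𝓝 z] h) :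
    𝔉.dbar₂ f z = 𝔉.dbar₂ h z := by
  simp only [dbar₂_apply, dbarAlong_congr_of_eventuallyEq hfh]

/-- `∂̄ u` is smooth for smooth `u`. [folklore] -/
theorem contDiff_dbar₁ {u : (ι → ℂ) → Λ₁} (hu : ContDiff ℝ ∞ u) : ContDiff ℝ ∞ (𝔉.dbar₁ u) := by
  unfold dbar₁
  exact ContDiff.sum fun j _ => ((𝔉.ε₁ j).restrictScalars ℝ).contDiff.comp
    (contDiff_infty_dbarAlong hu _)

/-- **`∂̄ ∂̄ = 0`** in the frame: for `u ∈ C²`, `∂̄ (∂̄ u) = ∑_{j,l} dz̄_j ∧ dz̄_l ∧ ∂²u/∂z̄_j∂z̄_l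
= 0`, by `dz̄_j ∧ dz̄_l = -dz̄_l ∧ dz̄_j` and the symmetry of `∂²u/∂z̄_j∂z̄_l`
(Hörmander (1973), §2.1). [cite: HormanderSCV1973, §2.1] -/
theorem dbar₂_dbar₁ {u : (ι → ℂ) → Λ₁} (hu : ContDiff ℝ ∞ u) (z : ι → ℂ) :
    𝔉.dbar₂ (𝔉.dbar₁ u) z = 0 := by
  have hd : ∀ l, Differentiable ℝ (dbarAlong (Pi.single l (1 : ℂ)) u) := fun l =>
    (contDiff_infty_dbarAlong hu _).differentiable (by simp)
  have h2 : (2 : WithTop ℕ∞) ≤ ∞ := by norm_cast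
  -- expand `∂̄ ∂̄ u` into the double sum `∑_j ∑_l ε_j ε_l ∂̄_j ∂̄_l u`
  have hexp : 𝔉.dbar₂ (𝔉.dbar₁ u) z = ∑ j, ∑ l, 𝔉.ε₂ j (𝔉.ε₁ l
      (dbarAlong (Pi.single j 1) (dbarAlong (Pi.single l 1) u) z)) := by
    simp only [dbar₂_apply]
    refine Finset.sum_congr rfl fun j _ => ?_
    have hdl : ∀ l, DifferentiableAt ℝ (fun y => 𝔉.ε₁ l (dbarAlong (Pi.single l 1) u y)) z :=
      fun l => ((𝔉.ε₁ l).restrictScalars ℝ).differentiableAt.comp z ((hd l) z)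
    unfold dbar₁
    rw [dbarAlong_finset_sum _ (fun l _ => hdl l), map_sum]
    refine Finset.sum_congr rfl fun l _ => ?_
    rw [dbarAlong_clm_comp (𝔉.ε₁ l) ((hd l) z)]
  rw [hexp]
  -- the summand is antisymmetric in `(j, l)`
  set a : ι → ι → Λ₃ := fun j l =>
    𝔉.ε₂ j (𝔉.ε₁ l (dbarAlong (Pi.single j 1) (dbarAlong (Pi.single l 1) u) z)) with ha_def
  have hanti : ∀ j l, a j l = -a l j := fun j l => by
    simp only [ha_def]
    rw [dbarAlong_comm hu.contDiffAt h2 (Pi.single j 1) (Pi.single l 1), 𝔉.ε_ε j l]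
  have hsum : ∑ j, ∑ l, a j l = -∑ j, ∑ l, a j l := by
    conv_rhs => rw [Finset.sum_comm]
    simp only [← Finset.sum_neg_distrib]
    exact Finset.sum_congr rfl fun j _ => Finset.sum_congr rfl fun l _ => hanti j l
  have h0 : (2 : ℂ) • ∑ j, ∑ l, a j l = 0 := by
    rw [two_smul]; nth_rw 1 [hsum]; exact neg_add_cancel _
  exact (smul_eq_zero.mp h0).resolve_left two_ne_zero

/-- **(2.3.4): the `dz̄_k`-coefficient of a `∂̄`-closed form not involving `dz̄_j` is holomorphic
in `z_j`.** If `f` is `C¹` near `y`, `∂̄ f (y) = 0`, and `∂/∂z̄_j ⌟ f = 0` near `y`, then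
`g = ∂/∂z̄_k ⌟ f` satisfies `∂g/∂z̄_j (y) = 0` (Hörmander (1973), proof of Thm. 2.3.3: "for this
is apart from a factor `±1` the coefficient of `dz^I ∧ dz̄^J ∧ dz̄_k ∧ dz̄_j` in `∂̄f`").
[cite: HormanderSCV1973, Thm. 2.3.3] -/
theorem dbarAlong_iota_eq_zero {f : (ι → ℂ) → Λ₂} {y : ι → ℂ} (hf : ContDiffAt ℝ 1 f y)
    (hcl : 𝔉.dbar₂ f y = 0) {j : ι} (hj : (fun w => 𝔉.ι₁ j (f w)) =ᶠ[𝓝 y] 0) (k : ι) :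
    dbarAlong (Pi.single j 1) (fun w => 𝔉.ι₁ k (f w)) y = 0 := by
  have hfd : DifferentiableAt ℝ f y := hf.differentiableAt one_ne_zero
  have hgd : ∀ m, DifferentiableAt ℝ (fun w => 𝔉.ι₁ m (f w)) y := fun m =>
    ((𝔉.ι₁ m).restrictScalars ℝ).differentiableAt.comp y hfd
  -- apply `ι_k` to `∂̄ f = 0`:  `∂̄_k f = ∑_l ε_l ∂̄_l (ι_k f)`
  have hstar : dbarAlong (Pi.single k 1) f y =
      ∑ l, 𝔉.ε₁ l (dbarAlong (Pi.single l 1) (fun w => 𝔉.ι₁ k (f w)) y) := by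
    have h1 : 𝔉.ι₂ k (𝔉.dbar₂ f y) = 0 := by rw [hcl, map_zero]
    rw [dbar₂_apply, map_sum] at h1
    have h2 : ∑ l, (𝔉.ι₂ k (𝔉.ε₂ l (dbarAlong (Pi.single l 1) f y)) +
        𝔉.ε₁ l (𝔉.ι₁ k (dbarAlong (Pi.single l 1) f y))) =
        dbarAlong (Pi.single k 1) f y := by
      rw [Finset.sum_eq_single k (fun l _ hl => 𝔉.car₂_ne k l (Ne.symm hl) _)
        (fun h => absurd (Finset.mem_univ k) h), 𝔉.car₂_self]
    rw [Finset.sum_add_distrib, h1, zero_add] at h2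
    rw [← h2]
    refine Finset.sum_congr rfl fun l _ => ?_
    rw [dbarAlong_clm_comp (𝔉.ι₁ k) hfd]
  -- apply `ι_j`: the left side vanishes since `ι_j f = 0` near `y`
  have hleft : 𝔉.ι₁ j (dbarAlong (Pi.single k 1) f y) = 0 := by
    rw [← dbarAlong_clm_comp (𝔉.ι₁ j) hfd, dbarAlong_eq_zero_of_eventuallyEq_zero hj]
  -- and the right side is `∂̄_j (ι_k f) - ∑_l ε₀_l ∂̄_l (ι₀_j ι_k f)` with `ι₀_j ι_k f = 0` near `y`
  have hright : 𝔉.ι₁ j (∑ l, 𝔉.ε₁ l (dbarAlong (Pi.single l 1) (fun w => 𝔉.ι₁ k (f w)) y)) =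
      dbarAlong (Pi.single j 1) (fun w => 𝔉.ι₁ k (f w)) y := by
    have hι0 : ∀ l, 𝔉.ι₀ j (dbarAlong (Pi.single l 1) (fun w => 𝔉.ι₁ k (f w)) y) = 0 := by
      intro l
      rw [← dbarAlong_clm_comp (𝔉.ι₀ j) (hgd k)]
      have h4 : (fun w => 𝔉.ι₀ j (𝔉.ι₁ k (f w))) =ᶠ[𝓝 y] 0 := by
        filter_upwards [hj] with w hw
        simp only [Pi.zero_apply] at hw ⊢
        rw [𝔉.ι_ι j k, hw, map_zero, neg_zero]
      exact dbarAlong_eq_zero_of_eventuallyEq_zero h4 _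
    rw [map_sum, Finset.sum_eq_single j (fun l _ hl => ?_) (fun h => absurd (Finset.mem_univ j) h)]
    · have := 𝔉.car₁_self j (dbarAlong (Pi.single j 1) (fun w => 𝔉.ι₁ k (f w)) y)
      rwa [hι0 j, map_zero, add_zero] at this
    · have := 𝔉.car₁_ne j l (Ne.symm hl) (dbarAlong (Pi.single l 1) (fun w => 𝔉.ι₁ k (f w)) y)
      rwa [hι0 l, map_zero, add_zero] at this
  have := congr_arg (𝔉.ι₁ j) hstar
  rwa [hleft, hright, eq_comm] at this

end DbarFrame

end Literature.Analysis.Complex
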